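import Summits.SmoothPoincare4.SmoothPoincare4.Theses.EntropyRung
import Literature.Geometry.Riemannian.GaussianShrinker
import Literature.Geometry.Riemannian.ShrinkingRoundSphereFour

/-!
# Two hypotheses of `ConicalGap` are load-bearing (negative lemmas for crux stmt-SmoothPoincare4-16589)

The crux `EntropyRung.ConicalGap` (route EntropyRung, rank 8; residue 1 of `NoncompactShrinkerGap`) asserts:
a connected NON-COMPACT complete 4-manifold with a smooth normalised gradient shrinking soliton structure
`Ric + Hess f = g/2`, `R + |∇f|² = f`, which is NON-FLAT (`R ≢ 0`) and whose scalar curvature tends to `0`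
at infinity (`∀ ε > 0 ∃ K` compact, `R < ε` off `K`) has `∫ e^{-f} dV ≤ 32π²√π e^{-3/2} = (4π)² Θ(S³×ℝ)`.
Kernel-checked here, over the tree's own vocabulary:

* `conicalGap_false_without_nonflat` — delete `∃ x, R x ≠ 0`: FALSE, witnessed by the Gaussian shrinker
  `(ℝ⁴, δ, |x|²/4)` (`R ≡ 0`, so the decay clause holds with `K = ∅`; `∫ e^{-f} dV = 16π² > 32π²√πe^{-3/2}`).
  In particular every hypothesis of the crux other than non-flatness — INCLUDING the new decay clause — is
  jointly satisfiable in the tree, and the bound is not vacuously true on that boundary of the class.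
* `conicalGap_false_without_noncompact` — delete `[NoncompactSpace M]`: FALSE, witnessed by the round
  shrinking sphere `S⁴(√6)`, `f ≡ 2` (the decay clause holds with `K = univ`; `∫ = 96π²e⁻² > 124.9`).
  So the decay clause does not by itself exclude the compact competitor: non-compactness stays load-bearing.

(The two other deletions refuted for the parent crux — completeness via `S⁴ ∖ pt`, normalisation via the
cylinder with `f − 1` — use witnesses with CONSTANT `R ∈ {2, 3/2}`, which violate the decay clause; for
`ConicalGap` they would need an asymptotically conical model such as FIK, not in the tree.)
Refuter negative lemmas (crux-attack), support the crux item; each statement is the crux text VERBATIM with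
exactly one clause removed (so `ConicalGap` follows from either un-negated statement by forgetting that clause).
-/

noncomputable section

set_option linter.dupNamespace false

namespace Summit.SmoothPoincare4.SmoothPoincare4.Theorems.ConicalGap.Negative

open scoped Manifold ContDiff ENNReal NNReal RealInnerProductSpace ContinuousMap
open MeasureTheory
open Literature.Geometry.Riemannian Literature.Geometry.Lorentzian
open Literature.Geometry.Lorentzian.PseudoRiemannianMetric

/-- **Non-flatness is load-bearing for `ConicalGap`** (and its other hypotheses, decay clause included, are
jointly satisfiable): the Gaussian shrinker `(ℝ⁴, δ, |x|²/4)` is complete, smooth, solves `Ric + Hess f = g/2`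
and `R + |∇f|² = f`, has `R ≡ 0` (so `R → 0` at infinity, `K = ∅`), and `∫ e^{-f} dV = 16π² > 32π²√πe^{-3/2}`
(`Θ(ℝ⁴) = 1 > Θ(S³×ℝ) = .791`). [cite: CaoHamiltonIlmanen2004, §4] -/
theorem conicalGap_false_without_nonflat :
    ¬ (∀ (M : Type) [TopologicalSpace M] [T2Space M] [SecondCountableTopology M]
        [ChartedSpace (EuclideanSpace ℝ (Fin 4)) M] [IsManifold (𝓡 4) ∞ M] [ConnectedSpace M]
        [NoncompactSpace M] [T3Space M] [MeasurableSpace M] [BorelSpace M]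
        (g : PseudoRiemannianMetric (𝓡 4) ∞ (EuclideanSpace ℝ (Fin 4)) (TangentSpace (𝓡 4) : M → Type _))
        [g.HasLeviCivita] (f : M → ℝ) (hg : g.IsRiemannian),
        (∀ (x : M) (r : NNReal), IsCompact {y : M | g.edist hg x y ≤ r}) →
        ContMDiff (𝓡 4) 𝓘(ℝ, ℝ) ∞ f →
        (∀ (x : M) (X Y : TangentSpace (𝓡 4) x),
          g.ricci x X Y + g.hessian f x X Y = (1 / 2 : ℝ) * g.val x X Y) →
        (∀ x : M, g.scalarCurvature x + g.gradSq f x = f x) →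
        (∀ ε : ℝ, 0 < ε → ∃ K : Set M, IsCompact K ∧ ∀ x, x ∉ K → g.scalarCurvature x < ε) →
        ∫⁻ x, ENNReal.ofReal (Real.exp (-f x))
            ∂(riemannianMeasure (g.toContMDiffRiemannianMetric hg)) ≤
          ENNReal.ofReal (32 * Real.pi ^ 2 * Real.sqrt Real.pi * Real.exp (-(3 : ℝ) / 2))) := by
  intro h
  have hsol : ∀ (x : EuclideanFour) (X Y : TangentSpace (𝓡 4) x),
      (euclideanMetric EuclideanFour).ricci x X Y +
          (euclideanMetric EuclideanFour).hessian gaussianPotential x X Y =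
        (1 / 2 : ℝ) * (euclideanMetric EuclideanFour).val x X Y := fun x X Y ↦ by
    rw [ricci_euclideanMetric, hessian_gaussianPotential, euclideanMetric_apply,
      LinearMap.zero_apply, LinearMap.zero_apply]
    ring_nf
    rfl
  have hnorm : ∀ x : EuclideanFour, (euclideanMetric EuclideanFour).scalarCurvature x +
      (euclideanMetric EuclideanFour).gradSq gaussianPotential x = gaussianPotential x := fun x ↦ by
    rw [scalarCurvature_euclideanMetric, gradSq_gaussianPotential, zero_add]
  have hdecay : ∀ ε : ℝ, 0 < ε → ∃ K : Set EuclideanFour, IsCompact K ∧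
      ∀ x, x ∉ K → (euclideanMetric EuclideanFour).scalarCurvature x < ε := fun ε hε ↦
    ⟨∅, isCompact_empty, fun x _ ↦ by rw [scalarCurvature_euclideanMetric]; exact hε⟩
  have key := h EuclideanFour (euclideanMetric EuclideanFour) gaussianPotential
    isRiemannian_euclideanMetric isCompact_setOf_edist_euclideanMetric_le
    contDiff_gaussianPotential.contMDiff hsol hnorm hdecay
  change ∫⁻ x, ENNReal.ofReal (Real.exp (-gaussianPotential x)) ∂(riemannianMeasure euclideanFourMetric)
    ≤ _ at key
  rw [riemannianMeasure_euclideanFour, lintegral_exp_neg_gaussianPotential,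
    ENNReal.ofReal_le_ofReal_iff (by positivity)] at key
  exact absurd key (not_le.mpr cylinderDensityBound_lt_gaussian)

/-- **Non-compactness is load-bearing for `ConicalGap`**: the round shrinking sphere `S⁴(√6) ⊂ ℝ⁵` with
`f ≡ 2` satisfies every hypothesis except non-compactness — the decay clause trivially, with `K = univ`
compact — while `∫ e^{-2} dV = 96π²e⁻² ≈ 128.2 > 124.9` (`Θ(S⁴) = 6/e² = .812 > .791`). So the decay
clause does not make `[NoncompactSpace M]` redundant. [cite: CaoHamiltonIlmanen2004, §4] -/
theorem conicalGap_false_without_noncompact :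
    ¬ (∀ (M : Type) [TopologicalSpace M] [T2Space M] [SecondCountableTopology M]
        [ChartedSpace (EuclideanSpace ℝ (Fin 4)) M] [IsManifold (𝓡 4) ∞ M] [ConnectedSpace M]
        [T3Space M] [MeasurableSpace M] [BorelSpace M]
        (g : PseudoRiemannianMetric (𝓡 4) ∞ (EuclideanSpace ℝ (Fin 4)) (TangentSpace (𝓡 4) : M → Type _))
        [g.HasLeviCivita] (f : M → ℝ) (hg : g.IsRiemannian),
        (∀ (x : M) (r : NNReal), IsCompact {y : M | g.edist hg x y ≤ r}) →
        ContMDiff (𝓡 4) 𝓘(ℝ, ℝ) ∞ f →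
        (∀ (x : M) (X Y : TangentSpace (𝓡 4) x),
          g.ricci x X Y + g.hessian f x X Y = (1 / 2 : ℝ) * g.val x X Y) →
        (∀ x : M, g.scalarCurvature x + g.gradSq f x = f x) →
        (∃ x : M, g.scalarCurvature x ≠ 0) →
        (∀ ε : ℝ, 0 < ε → ∃ K : Set M, IsCompact K ∧ ∀ x, x ∉ K → g.scalarCurvature x < ε) →
        ∫⁻ x, ENNReal.ofReal (Real.exp (-f x))
            ∂(riemannianMeasure (g.toContMDiffRiemannianMetric hg)) ≤
          ENNReal.ofReal (32 * Real.pi ^ 2 * Real.sqrt Real.pi * Real.exp (-(3 : ℝ) / 2))) := by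
  intro h
  haveI : Nonempty SphereFour := (NormedSpace.sphere_nonempty.2 zero_le_one).to_subtype
  have hsol : ∀ (x : SphereFour) (X Y : TangentSpace (𝓡 4) x),
      shrinkingSphereFourMetric.ricci x X Y +
          shrinkingSphereFourMetric.hessian (fun _ ↦ (2 : ℝ)) x X Y =
        (1 / 2 : ℝ) * shrinkingSphereFourMetric.val x X Y := by
    intro x X Y
    rw [ricci_shrinkingSphereFourMetric, shrinkingSphereFourMetric.hessian_constFun,
      LinearMap.zero_apply, LinearMap.zero_apply, add_zero]
  have hnorm : ∀ x : SphereFour, shrinkingSphereFourMetric.scalarCurvature x +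
      shrinkingSphereFourMetric.gradSq (fun _ ↦ (2 : ℝ)) x = 2 := by
    intro x
    rw [scalarCurvature_shrinkingSphereFourMetric, PseudoRiemannianMetric.gradSq_const, add_zero]
  have hnf : ∃ x : SphereFour, shrinkingSphereFourMetric.scalarCurvature x ≠ 0 :=
    ⟨Classical.arbitrary SphereFour, by rw [scalarCurvature_shrinkingSphereFourMetric]; norm_num⟩
  have hdecay : ∀ ε : ℝ, 0 < ε → ∃ K : Set SphereFour, IsCompact K ∧
      ∀ x, x ∉ K → shrinkingSphereFourMetric.scalarCurvature x < ε := fun ε _ ↦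
    ⟨Set.univ, isCompact_univ, fun x hx ↦ absurd (Set.mem_univ x) hx⟩
  have key := h SphereFour shrinkingSphereFourMetric (fun _ ↦ (2 : ℝ))
    isRiemannian_shrinkingSphereFourMetric isCompact_setOf_edist_shrinkingSphereFour_le
    contMDiff_const hsol hnorm hnf hdecay
  rw [lintegral_exp_neg_two_shrinkingSphereFour, ENNReal.ofReal_le_ofReal_iff (by positivity)] at key
  exact absurd key (not_le.mpr cylinderDensityBound_lt_shrinkingSphereFour)

end Summit.SmoothPoincare4.SmoothPoincare4.Theorems.ConicalGap.Negative

end
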